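import Summits.QuantumFields.YangMills.Theorems.BalabanUVNodesN21ThresholdSelection

/-!
# YM-DAG node N21 (= NE7c) — ROAD I AT SELECTED THRESHOLDS: the level ledgers at SHARP carriers, (M1) PROVED at one admissible threshold per
# (comparison, level), chosen level by level against older-measurable dominating laws (lens Card 10 + Card 9; ROW A″ of `LENS-nearmiss.md` v4.0 —
# the SELECTION twin of module 12a `BalabanUVNodesN21LevelLedgerMixture`, same binder shapes minus the window-average pins)

Track A of `YM-PLAN.md` (cell `pub-ymgap`, HUMAN RULING D-0062), node **N21**; R134 fan-out seat `pub-ymgap-dag-n21-d` (s2), generation 4, module 18b.  THEOREMS ONLY: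
0 `def`, 0 `sorry`, standard axioms; COUNT-NEUTRAL; `--supports` the K3′ item `SpineGivenEndpointR12` (stmt-QuantumFields-19908) as a helper.  `N`-generic, NO Theses
import (restate-immune).  Imports module 18a `BalabanUVNodesN21ThresholdSelection` (= the planner seat `ym-lens-BalabanUVNodes-nearmiss` g4's sketch §A∕§B∕§E verbatim, credited there:
`exists_threshold_forall_slotAntiConcentration`, `exists_sequential_assignment`, `slot_field_of_antiConcentration_loss`); §2–§3 below are this seat's (ROW A″ §2–§3 of
`LENS-nearmiss.md` v4.0 33b38bc0ae91db7d).

THE POINT.  Road I's only analytic binder is the `LevelLedger.slot` field — (M1)-by-level, an anti-concentration statement `T4ShellMeasure.SlotAntiConcentration` for the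
law of each tested variable at its threshold, NOT PRINTED for Bałaban's procedure at its printed thresholds.  Module 12a (ROW A′) made it a Fubini THEOREM at WINDOW-AVERAGED
carriers (a convex combination of print's sharp procedure over admissible thresholds — honest-label gap: not print's construction verbatim).  HERE: for ANY finite family
of finite laws SOME threshold of every admissible window `[(1 − κ)θ, θ]` satisfies `SlotAntiConcentration` for ALL members at once with `D = #F∕((1 − ρ)κ)` (module 18a: the
window integral of the shell mass is the mixture road's `thresholdMixture_shell_le`; a function is somewhere below its average — NO hypothesis on the laws); selecting
LEVEL BY LEVEL, oldest first, against dominating laws that read only OLDER thresholds (`exists_sequential_assignment`), every comparison `K` gets ONE admissible threshold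
vector at which BOTH runs' level ledgers hold AT SHARP CARRIERS — print's own expansion at the chosen thresholds (§2), hence road I's `ShellWeightBound` with a geometric
weight (§3).  The thresholds are CHOSEN inside the admissible windows (road (δ)'s lever, `T4ShellMeasure` §6–§8's discrete ancestor `exists_common_threshold`), not
printed; (M1) for print's FIXED printed thresholds is untouched.

WHAT IS PROVED ([folklore] measure theory + bookkeeping; no decl carries a cite tag).
* §2 SELECTION PER COMPARISON, grouping = LEVEL: both runs' slots on one index type `σ` (families `SA K`, `SB K`, levels `lvl K s`), spaces `X K s`, t-FREE measurable
  statistics `w K s`, finite laws `ν K a s` depending on the threshold ASSIGNMENT `a : ℕ → ℝ` only through OLDER levels (`hdep`), at most `F̄` slots per level (both runs):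
  `exists_goodAssignment` (∀ K ∃ admissible `a`, every slot of level `≤ K` of either run has `SlotAntiConcentration (ν K a s) (w K s) (a (lvl s)) (ρ (lvl s)) (F̄∕((1−ρ)κ))`);
  `levelLedger_of_goodAssignment` (one run, SHARP letters `A K a t τ` ∕ `sh K a t τ` ∕ `piece K a t s τ` at a good assignment + (R) + the two pushes with losses `M₁`
  (pieces vs the slot's shell mass AT ITS LEVEL's threshold) ∕ `M₂` (totals) ⇒ `LevelLedger … (D j := M₁∕M₂ · D′ j) ρ` — no `hpieceMix`∕`hAMix`, no (M1) binder);
  `levelLedgers_of_selectedThresholds` (∃ ONE admissible assignment per comparison at which BOTH runs' ledgers hold, `D j = M₁∕M₂ · F̄∕((1 − ρ_j)κ_j)`).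
* §3 `shellWeightBound_geometric_of_selectedThresholds` (+ N20's live windows, `κ_min ≤ κ_j`, `ρ_j ≤ ½`, the rate `ρ_j ≤ c₁ϑ^j` (N16) ⇒ ∃ admissible assignment with
  `ShellWeightBound l₀ T (A·(a·)) (B·(a·)) (shA·(a·)) (shB·(a·)) (C·ϑ^K)`, `C = 2((N₁+1)ν̄·(2(M₁∕M₂)F̄∕κ_min)·c₁ϑ^{−N₁})` — n21-a's `n21_knit_levels_geometric`);
  `s_N21_of_selectedSharpReading` (the K5 stub `S_N21 SRec` for every reading pinning bundles whose carriers ARE a threshold-parametric sharp object READ AT an admissible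
  assignment carrying the selection certificate).

HONEST FRAMING (binding).  DISPLAYED, not discharged: NODE O's THRESHOLD-PARAMETRIC sharp term object over the admissible box (the `A K a t τ`, `sh`, `piece` letters and
their (R) facts at every assignment); the pushes against OLDER-MEASURABLE, t-free dominating laws with losses `M₁` ((R) + (PD), lens Card 8) and `M₂` (global mass control) —
E-class inputs; admissibility of every threshold vector of the box for print's single-run bounds ((L1-step) ∕ U2); the tilt (lens census jj); road I's live windows (N20),
slot count, rates (N16; R-β base per module 15).  Nothing of Bałaban's is asserted or instantiated; NE7c is NOT PRINTED and NOT PROVED; **N21 is NOT discharged**; typed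
28∕28, discharged count untouched; one finite four-torus programme at fixed `ε` — NOT ℝ⁴, NOT infinite volume, NOT OS, NOT a mass gap, NOT Clay.
-/

set_option autoImplicit false

noncomputable section

open scoped BigOperators ENNReal
open MeasureTheory Set

namespace Summit.QuantumFields.YangMills.Theorems.N21SelectedThresholds

open Literature.MathematicalPhysics.QuantumFieldTheory.Balaban1983to89
open Literature.MathematicalPhysics.QuantumFieldTheory.Balaban1983to89.T4ShellMeasure (SlotAntiConcentration)
open Literature.MathematicalPhysics.QuantumFieldTheory.Balaban1983to89.T4ShellMeasureFibre (slotAntiConcentration_mono)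
open T4IndicatorShell (ShellWeightBound)
open T4ShellMeasureLevels (LevelLedger LiveWindow)
open YMDAG.UVSplit (SpineCarriers SpineRecordPred S_N21)
open N21ThresholdSelection (exists_threshold_forall_slotAntiConcentration exists_sequential_assignment slot_field_of_antiConcentration_loss)

/-! ## §2 SELECTION PER COMPARISON, grouping = LEVEL: one admissible threshold per (K, level), shared by both runs' slots of that level -/

section PerComparison

variable {ι σ : Type*} [DecidableEq σ] {X : ℕ → σ → Type*} [∀ K s, MeasurableSpace (X K s)]
  {SA SB : ℕ → Finset σ} {lvl : ℕ → σ → ℕ}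
  {ν : ∀ K : ℕ, (ℕ → ℝ) → ∀ s : σ, Measure (X K s)} [∀ K a s, IsFiniteMeasure (ν K a s)]
  {w : ∀ (K : ℕ) (s : σ), X K s → ℝ} {θ κ ρ : ℕ → ℝ} {Fbar : ℝ}

/-- **ONE GOOD ADMISSIBLE THRESHOLD VECTOR PER COMPARISON.**  DATA (comparison `K` of the two runs): the slots of both runs on one index type `σ` (`SA K`, `SB K`) with
levels `lvl K s`; per slot a measurable space `X K s`, a measurable, `t`-free tested statistic `w K s` (in the units of its level's nominal threshold `θ_j > 0`), and a finite
DOMINATING LAW `ν K a s` depending on the threshold ASSIGNMENT `a : ℕ → ℝ` (one threshold per level) ONLY THROUGH THE OLDER LEVELS `a i`, `i < lvl K s` (`hdep`: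
older-measurable — parent densities, lens Card 8); windows `[(1 − κ_j)θ_j, θ_j]` (`0 < κ_j ≤ 1`), relative widths `0 ≤ ρ_j < 1`; at most `F̄` slots per level over both runs.
CONCLUSION: some assignment `a` with every `a j` in its window such that EVERY slot of either run at a level `≤ K` satisfies (M1) at ITS level's threshold:
`SlotAntiConcentration (ν K a s) (w K s) (a (lvl K s)) (ρ_{lvl}) (F̄∕((1 − ρ_{lvl})κ_{lvl}))` — §1's `exists_threshold_forall_slotAntiConcentration` on each level's
joint family, threaded oldest-first by `exists_sequential_assignment`. [folklore] -/
theorem exists_goodAssignment (hw : ∀ K s, Measurable (w K s)) (hθ : ∀ j, 0 < θ j) (hκ : ∀ j, 0 < κ j ∧ κ j ≤ 1)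
    (hρ : ∀ j, 0 ≤ ρ j ∧ ρ j < 1)
    (hdep : ∀ (K : ℕ) (s : σ) (a b : ℕ → ℝ), (∀ i, i < lvl K s → a i = b i) → ν K a s = ν K b s)
    (hcard : ∀ K m, ((((SA K ∪ SB K).filter fun s => lvl K s = m).card : ℕ) : ℝ) ≤ Fbar) (K : ℕ) :
    ∃ a : ℕ → ℝ, (∀ j, a j ∈ Icc ((1 - κ j) * θ j) (θ j)) ∧
      ∀ s ∈ SA K ∪ SB K, lvl K s ≤ K →
        SlotAntiConcentration (ν K a s) (w K s) (a (lvl K s)) (ρ (lvl K s)) (Fbar / ((1 - ρ (lvl K s)) * κ (lvl K s))) := by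
  -- the level-`m` goodness predicate and its older-measurability
  set Good : ℕ → (ℕ → ℝ) → Prop := fun m a =>
    ∀ s ∈ (SA K ∪ SB K).filter (fun s => lvl K s = m),
      SlotAntiConcentration (ν K a s) (w K s) (a m) (ρ m) (Fbar / ((1 - ρ m) * κ m)) with hGood
  have hdep' : ∀ m a b, (∀ i ≤ m, a i = b i) → Good m a → Good m b := by
    intro m a b hab h s hs
    have hlv : lvl K s = m := (Finset.mem_filter.1 hs).2
    have hν : ν K a s = ν K b s := hdep K s a b fun i hi => hab i (by rw [hlv] at hi; exact hi.le)
    have := h s hs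
    rw [hν, hab m le_rfl] at this
    exact this
  have hstep : ∀ m (a : ℕ → ℝ), ∃ t ∈ Icc ((1 - κ m) * θ m) (θ m), Good m (Function.update a m t) := by
    intro m a
    set F : Finset σ := (SA K ∪ SB K).filter (fun s => lvl K s = m) with hF
    obtain ⟨t, ht, hac⟩ := exists_threshold_forall_slotAntiConcentration F (fun s => ν K a s) (fun s => hw K s)
      (hθ m) (hκ m).1 (hκ m).2 (hρ m).1 (hρ m).2
    refine ⟨t, ht, fun s hs => ?_⟩
    have hlv : lvl K s = m := (Finset.mem_filter.1 hs).2
    have hν : ν K (Function.update a m t) s = ν K a s :=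
      hdep K s _ a fun i hi => by
        have hne : i ≠ m := Nat.ne_of_lt (by rw [hlv] at hi; exact hi)
        rw [Function.update_apply, if_neg hne]
    have h1ρ : 0 < 1 - ρ m := by linarith [(hρ m).2]
    have hDD : (F.card : ℝ) / ((1 - ρ m) * κ m) ≤ Fbar / ((1 - ρ m) * κ m) :=
      div_le_div_of_nonneg_right (hcard K m) (mul_pos h1ρ (hκ m).1).le
    rw [hν, Function.update_apply, if_pos rfl]
    exact slotAntiConcentration_mono (hρ m).1 hDD (hac s hs)
  -- select levels `0 … K`, then freeze the admissible top `θ j` above `K`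
  obtain ⟨a, ha⟩ := exists_sequential_assignment (fun j => Icc ((1 - κ j) * θ j) (θ j)) Good hdep' hstep (K + 1)
  refine ⟨fun j => if j ≤ K then a j else θ j, fun j => ?_, fun s hs hle => ?_⟩
  · dsimp only
    by_cases hj : j ≤ K
    · rw [if_pos hj]; exact (ha j (Nat.lt_succ_of_le hj)).1
    · rw [if_neg hj]
      exact ⟨by nlinarith [(hκ j).1, hθ j], le_rfl⟩
  · have hgood := (ha (lvl K s) (Nat.lt_succ_of_le hle)).2 s (Finset.mem_filter.2 ⟨hs, rfl⟩)
    have hν : ν K (fun j => if j ≤ K then a j else θ j) s = ν K a s :=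
      hdep K s _ a fun i hi => by rw [if_pos (le_trans hi.le hle)]
    rw [hν]
    dsimp only
    rw [if_pos hle]
    exact hgood

variable {l₀ : ℝ} {T : ℕ → Finset ι}

omit [DecidableEq σ] in
/-- **ONE RUN: road I's `LevelLedger` AT SHARP CARRIERS from a good admissible assignment.**  DATA: per comparison `K` an assignment `a K` at which every slot of the
run's family `S K` satisfies (M1) with constant `D′ (lvl K s)` (`hgood` — §2's `exists_goodAssignment`), SHARP letters AT THAT ASSIGNMENT — term weights `A K (a K) t τ`,
shell parts `sh K (a K) t τ`, per-slot pieces `piece K (a K) t s τ` — with the (R) facts (`sh ≥ 0`, `sh ≤` weight, cover by the pieces) and, for every `|t| ≤ l₀` and slot,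
the piece push at loss `M₁ ≥ 0` against the law's shell mass AT THE SLOT's LEVEL THRESHOLD and the total push at `M₂ > 0`.  CONCLUSION:
`LevelLedger l₀ T (A·(a·)) (sh·(a·)) S (piece·(a·)) lvl (j ↦ (M₁∕M₂)·D′ j) ρ` — `slot_field_of_antiConcentration_loss` per slot; NO window-average pin, NO (M1) binder. [folklore] -/
theorem levelLedger_of_goodAssignment {S : ℕ → Finset σ} {A sh : ℕ → (ℕ → ℝ) → ℝ → ι → ℝ}
    {piece : ℕ → (ℕ → ℝ) → ℝ → σ → ι → ℝ} {M₁ M₂ : ℝ} {D' : ℕ → ℝ} (a : ℕ → ℕ → ℝ)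
    (hgood : ∀ K, ∀ s ∈ S K, SlotAntiConcentration (ν K (a K) s) (w K s) (a K (lvl K s)) (ρ (lvl K s)) (D' (lvl K s)))
    (hD' : ∀ j, 0 ≤ D' j) (hρ0 : ∀ j, 0 ≤ ρ j) (hM₁ : 0 ≤ M₁) (hM₂ : 0 < M₂)
    (sh_nonneg : ∀ K t, |t| ≤ l₀ → ∀ τ ∈ T K, 0 ≤ sh K (a K) t τ)
    (sh_le : ∀ K t, |t| ≤ l₀ → ∀ τ ∈ T K, sh K (a K) t τ ≤ A K (a K) t τ)
    (cover : ∀ K t, |t| ≤ l₀ → ∀ τ ∈ T K, sh K (a K) t τ ≤ ∑ s ∈ S K, piece K (a K) t s τ)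
    (hpush : ∀ K t, |t| ≤ l₀ → ∀ s ∈ S K, ∑ τ ∈ T K, piece K (a K) t s τ ≤
      M₁ * (ν K (a K) s {x | a K (lvl K s) * (1 - ρ (lvl K s)) ≤ w K s x ∧ w K s x < a K (lvl K s)}).toReal)
    (htotal : ∀ K t, |t| ≤ l₀ → ∀ s ∈ S K, M₂ * (ν K (a K) s univ).toReal ≤ ∑ τ ∈ T K, A K (a K) t τ) :
    LevelLedger l₀ T (fun K => A K (a K)) (fun K => sh K (a K)) S (fun K => piece K (a K)) lvl (fun j => M₁ / M₂ * D' j) ρ where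
  sh_nonneg := sh_nonneg
  sh_le := sh_le
  cover := cover
  slot K t ht s hs :=
    slot_field_of_antiConcentration_loss (hD' _) (hρ0 _) (hgood K s hs) (T K) hM₁ hM₂ (hpush K t ht s hs) (htotal K t ht s hs)
  D_nonneg j := by have := hD' j; have := hM₂.le; positivity
  ρ_nonneg := hρ0

/-- **TWO RUNS: BOTH LEVEL LEDGERS AT THE SAME SELECTED THRESHOLDS.**  DATA as in `exists_goodAssignment` (slots, levels, spaces, t-free statistics, older-measurable
dominating laws, windows, widths, `F̄`) with every slot of comparison `K` at a level `≤ K` (N20's window, `hle`), plus THRESHOLD-PARAMETRIC SHARP LETTERS of both runs —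
`A K a t τ`, `shA K a t τ`, `pieceA K a t s τ` and the B-twins, functions of the WHOLE assignment `a` (NODE O's term object over the admissible box) — with, AT EVERY
ADMISSIBLE ASSIGNMENT and every `|t| ≤ l₀`: the (R) facts and the two pushes with losses `M₁ ≥ 0` (pieces vs the slot's law's shell mass at the slot's level threshold) and
`M₂ > 0` (totals).  CONCLUSION: ONE assignment `a K` per comparison, admissible at every level, at which BOTH runs' `LevelLedger`s hold with
`D j = (M₁∕M₂)·F̄∕((1 − ρ_j)κ_j)` — road I's binders `hA`, `hB` of `n21_knit_levels` AT SHARP CARRIERS, (M1) PROVED, no window average. [folklore] -/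
theorem levelLedgers_of_selectedThresholds {A shA B shB : ℕ → (ℕ → ℝ) → ℝ → ι → ℝ}
    {pieceA pieceB : ℕ → (ℕ → ℝ) → ℝ → σ → ι → ℝ} {M₁ M₂ : ℝ}
    (hw : ∀ K s, Measurable (w K s)) (hθ : ∀ j, 0 < θ j) (hκ : ∀ j, 0 < κ j ∧ κ j ≤ 1) (hρ : ∀ j, 0 ≤ ρ j ∧ ρ j < 1)
    (hdep : ∀ (K : ℕ) (s : σ) (a b : ℕ → ℝ), (∀ i, i < lvl K s → a i = b i) → ν K a s = ν K b s)
    (hFbar : 0 ≤ Fbar) (hcard : ∀ K m, ((((SA K ∪ SB K).filter fun s => lvl K s = m).card : ℕ) : ℝ) ≤ Fbar)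
    (hle : ∀ K, ∀ s ∈ SA K ∪ SB K, lvl K s ≤ K) (hM₁ : 0 ≤ M₁) (hM₂ : 0 < M₂)
    (hRA : ∀ (K : ℕ) (a : ℕ → ℝ), (∀ j, a j ∈ Icc ((1 - κ j) * θ j) (θ j)) → ∀ t, |t| ≤ l₀ → ∀ τ ∈ T K,
      0 ≤ shA K a t τ ∧ shA K a t τ ≤ A K a t τ ∧ shA K a t τ ≤ ∑ s ∈ SA K, pieceA K a t s τ)
    (hpushA : ∀ (K : ℕ) (a : ℕ → ℝ), (∀ j, a j ∈ Icc ((1 - κ j) * θ j) (θ j)) → ∀ t, |t| ≤ l₀ → ∀ s ∈ SA K,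
      ∑ τ ∈ T K, pieceA K a t s τ ≤ M₁ * (ν K a s {x | a (lvl K s) * (1 - ρ (lvl K s)) ≤ w K s x ∧ w K s x < a (lvl K s)}).toReal)
    (htotalA : ∀ (K : ℕ) (a : ℕ → ℝ), (∀ j, a j ∈ Icc ((1 - κ j) * θ j) (θ j)) → ∀ t, |t| ≤ l₀ → ∀ s ∈ SA K,
      M₂ * (ν K a s univ).toReal ≤ ∑ τ ∈ T K, A K a t τ)
    (hRB : ∀ (K : ℕ) (a : ℕ → ℝ), (∀ j, a j ∈ Icc ((1 - κ j) * θ j) (θ j)) → ∀ t, |t| ≤ l₀ → ∀ τ ∈ T K,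
      0 ≤ shB K a t τ ∧ shB K a t τ ≤ B K a t τ ∧ shB K a t τ ≤ ∑ s ∈ SB K, pieceB K a t s τ)
    (hpushB : ∀ (K : ℕ) (a : ℕ → ℝ), (∀ j, a j ∈ Icc ((1 - κ j) * θ j) (θ j)) → ∀ t, |t| ≤ l₀ → ∀ s ∈ SB K,
      ∑ τ ∈ T K, pieceB K a t s τ ≤ M₁ * (ν K a s {x | a (lvl K s) * (1 - ρ (lvl K s)) ≤ w K s x ∧ w K s x < a (lvl K s)}).toReal)
    (htotalB : ∀ (K : ℕ) (a : ℕ → ℝ), (∀ j, a j ∈ Icc ((1 - κ j) * θ j) (θ j)) → ∀ t, |t| ≤ l₀ → ∀ s ∈ SB K,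
      M₂ * (ν K a s univ).toReal ≤ ∑ τ ∈ T K, B K a t τ) :
    ∃ a : ℕ → ℕ → ℝ, (∀ K j, a K j ∈ Icc ((1 - κ j) * θ j) (θ j)) ∧
      LevelLedger l₀ T (fun K => A K (a K)) (fun K => shA K (a K)) SA (fun K => pieceA K (a K)) lvl
        (fun j => M₁ / M₂ * (Fbar / ((1 - ρ j) * κ j))) ρ ∧
      LevelLedger l₀ T (fun K => B K (a K)) (fun K => shB K (a K)) SB (fun K => pieceB K (a K)) lvl
        (fun j => M₁ / M₂ * (Fbar / ((1 - ρ j) * κ j))) ρ := by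
  choose a hadm hgood using fun K => exists_goodAssignment (SA := SA) (SB := SB) hw hθ hκ hρ hdep hcard K
  have hD' : ∀ j, 0 ≤ Fbar / ((1 - ρ j) * κ j) := fun j => by
    have h1 : 0 < 1 - ρ j := by linarith [(hρ j).2]
    have h2 := (hκ j).1
    positivity
  refine ⟨a, fun K j => hadm K j, ?_, ?_⟩
  · exact levelLedger_of_goodAssignment a
      (fun K s hs => hgood K s (Finset.mem_union_left _ hs) (hle K s (Finset.mem_union_left _ hs)))
      hD' (fun j => (hρ j).1) hM₁ hM₂
      (fun K t ht τ hτ => (hRA K (a K) (hadm K) t ht τ hτ).1) (fun K t ht τ hτ => (hRA K (a K) (hadm K) t ht τ hτ).2.1)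
      (fun K t ht τ hτ => (hRA K (a K) (hadm K) t ht τ hτ).2.2) (fun K t ht s hs => hpushA K (a K) (hadm K) t ht s hs)
      (fun K t ht s hs => htotalA K (a K) (hadm K) t ht s hs)
  · exact levelLedger_of_goodAssignment a
      (fun K s hs => hgood K s (Finset.mem_union_right _ hs) (hle K s (Finset.mem_union_right _ hs)))
      hD' (fun j => (hρ j).1) hM₁ hM₂
      (fun K t ht τ hτ => (hRB K (a K) (hadm K) t ht τ hτ).1) (fun K t ht τ hτ => (hRB K (a K) (hadm K) t ht τ hτ).2.1)
      (fun K t ht τ hτ => (hRB K (a K) (hadm K) t ht τ hτ).2.2) (fun K t ht s hs => hpushB K (a K) (hadm K) t ht s hs)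
      (fun K t ht s hs => htotalB K (a K) (hadm K) t ht s hs)

/-! ## §3 Road I's `ShellWeightBound` at the selected thresholds, and the K5 stub for selected sharp readings -/

/-- `F̄∕((1 − ρ_j)κ_j) ≤ 2F̄∕κ_min` for `ρ_j ≤ ½`, `0 < κ_min ≤ κ_j`, `F̄ ≥ 0`. [folklore] -/
theorem levelConst_le {Fbar ρj κj κmin : ℝ} (hF : 0 ≤ Fbar) (hρ : ρj ≤ 1 / 2) (hκmin : 0 < κmin) (hκ : κmin ≤ κj) :
    Fbar / ((1 - ρj) * κj) ≤ 2 * Fbar / κmin := by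
  have hκj : 0 < κj := lt_of_lt_of_le hκmin hκ
  have hden : κmin / 2 ≤ (1 - ρj) * κj := by nlinarith
  rw [show 2 * Fbar / κmin = Fbar / (κmin / 2) by field_simp]
  exact div_le_div_of_nonneg_left hF (by positivity) hden

/-- **N21's ROAD I AT SELECTED THRESHOLDS.**  The data of `levelLedgers_of_selectedThresholds` + N20's live windows `(N₁, ν̄)` for both slot families + `0 < κ_min ≤ κ_j` +
`ρ_j ≤ ½` + the width rate `0 < ϑ < 1`, `ρ_j ≤ c₁ϑ^j` (N16) ⟹ for SOME assignment `a K` per comparison, admissible at every level, road I's conclusion AT SHARP CARRIERS: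
`ShellWeightBound l₀ T (A·(a·)) (B·(a·)) (shA·(a·)) (shB·(a·)) (K ↦ C·ϑ^K)` with `C = 2((N₁+1)·ν̄·(M₁∕M₂·(2F̄∕κ_min))·c₁·ϑ^{−N₁})` — n21-a's `n21_knit_levels_geometric`
(p408928) on §2's two ledgers; (M1) PROVED at the selected thresholds, nothing averaged. [folklore] -/
theorem shellWeightBound_geometric_of_selectedThresholds {A shA B shB : ℕ → (ℕ → ℝ) → ℝ → ι → ℝ}
    {pieceA pieceB : ℕ → (ℕ → ℝ) → ℝ → σ → ι → ℝ} {M₁ M₂ : ℝ} {N₁ : ℕ} {νbar κmin c₁ ϑ : ℝ}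
    (hw : ∀ K s, Measurable (w K s)) (hθ : ∀ j, 0 < θ j) (hκ : ∀ j, 0 < κ j ∧ κ j ≤ 1) (hρ : ∀ j, 0 ≤ ρ j ∧ ρ j < 1)
    (hdep : ∀ (K : ℕ) (s : σ) (a b : ℕ → ℝ), (∀ i, i < lvl K s → a i = b i) → ν K a s = ν K b s)
    (hFbar : 0 ≤ Fbar) (hcard : ∀ K m, ((((SA K ∪ SB K).filter fun s => lvl K s = m).card : ℕ) : ℝ) ≤ Fbar)
    (hM₁ : 0 ≤ M₁) (hM₂ : 0 < M₂)
    (hRA : ∀ (K : ℕ) (a : ℕ → ℝ), (∀ j, a j ∈ Icc ((1 - κ j) * θ j) (θ j)) → ∀ t, |t| ≤ l₀ → ∀ τ ∈ T K,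
      0 ≤ shA K a t τ ∧ shA K a t τ ≤ A K a t τ ∧ shA K a t τ ≤ ∑ s ∈ SA K, pieceA K a t s τ)
    (hpushA : ∀ (K : ℕ) (a : ℕ → ℝ), (∀ j, a j ∈ Icc ((1 - κ j) * θ j) (θ j)) → ∀ t, |t| ≤ l₀ → ∀ s ∈ SA K,
      ∑ τ ∈ T K, pieceA K a t s τ ≤ M₁ * (ν K a s {x | a (lvl K s) * (1 - ρ (lvl K s)) ≤ w K s x ∧ w K s x < a (lvl K s)}).toReal)
    (htotalA : ∀ (K : ℕ) (a : ℕ → ℝ), (∀ j, a j ∈ Icc ((1 - κ j) * θ j) (θ j)) → ∀ t, |t| ≤ l₀ → ∀ s ∈ SA K,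
      M₂ * (ν K a s univ).toReal ≤ ∑ τ ∈ T K, A K a t τ)
    (hRB : ∀ (K : ℕ) (a : ℕ → ℝ), (∀ j, a j ∈ Icc ((1 - κ j) * θ j) (θ j)) → ∀ t, |t| ≤ l₀ → ∀ τ ∈ T K,
      0 ≤ shB K a t τ ∧ shB K a t τ ≤ B K a t τ ∧ shB K a t τ ≤ ∑ s ∈ SB K, pieceB K a t s τ)
    (hpushB : ∀ (K : ℕ) (a : ℕ → ℝ), (∀ j, a j ∈ Icc ((1 - κ j) * θ j) (θ j)) → ∀ t, |t| ≤ l₀ → ∀ s ∈ SB K,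
      ∑ τ ∈ T K, pieceB K a t s τ ≤ M₁ * (ν K a s {x | a (lvl K s) * (1 - ρ (lvl K s)) ≤ w K s x ∧ w K s x < a (lvl K s)}).toReal)
    (htotalB : ∀ (K : ℕ) (a : ℕ → ℝ), (∀ j, a j ∈ Icc ((1 - κ j) * θ j) (θ j)) → ∀ t, |t| ≤ l₀ → ∀ s ∈ SB K,
      M₂ * (ν K a s univ).toReal ≤ ∑ τ ∈ T K, B K a t τ)
    (hwinA : LiveWindow SA lvl N₁ νbar) (hwinB : LiveWindow SB lvl N₁ νbar)
    (hκmin : 0 < κmin) (hκminle : ∀ j, κmin ≤ κ j) (hρhalf : ∀ j, ρ j ≤ 1 / 2)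
    (hϑ0 : 0 < ϑ) (hϑ1 : ϑ < 1) (hrate : ∀ j, ρ j ≤ c₁ * ϑ ^ j) :
    ∃ a : ℕ → ℕ → ℝ, (∀ K j, a K j ∈ Icc ((1 - κ j) * θ j) (θ j)) ∧
      ShellWeightBound l₀ T (fun K => A K (a K)) (fun K => B K (a K)) (fun K => shA K (a K)) (fun K => shB K (a K))
        fun K => (2 * ((N₁ + 1) * νbar * (M₁ / M₂ * (2 * Fbar / κmin)) * c₁ * ϑ⁻¹ ^ N₁)) * ϑ ^ K := by
  have hle : ∀ K, ∀ s ∈ SA K ∪ SB K, lvl K s ≤ K := fun K s hs => by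
    rcases Finset.mem_union.1 hs with h | h
    · exact hwinA.le_top K s h
    · exact hwinB.le_top K s h
  obtain ⟨a, hadm, hLA, hLB⟩ := levelLedgers_of_selectedThresholds hw hθ hκ hρ hdep hFbar hcard hle hM₁ hM₂ hRA hpushA htotalA
    hRB hpushB htotalB
  have hD : ∀ j, M₁ / M₂ * (Fbar / ((1 - ρ j) * κ j)) ≤ M₁ / M₂ * (2 * Fbar / κmin) := fun j =>
    mul_le_mul_of_nonneg_left (levelConst_le hFbar (hρhalf j) hκmin (hκminle j)) (div_nonneg hM₁ hM₂.le)
  exact ⟨a, hadm, n21_knit_levels_geometric hLA hLB hwinA hwinB hD hD hϑ0 hϑ1 hrate hrate⟩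

end PerComparison

/-! ### The K5 stub at every SELECTED SHARP reading -/

section AtCarriers

variable {N : ℕ} [NeZero N]

/-- **`S_N21` FOR EVERY SELECTED SHARP READING.**  If every bundle `S` the reading predicate `SRec` pins carries: the slot bookkeeping of both runs on one index type
(families, levels, spaces, t-free measurable statistics, older-measurable finite dominating laws `ν K a s`, windows `θ_j, κ_j`, widths `ρ_j`, level count `F̄`), a
THRESHOLD-PARAMETRIC SHARP OBJECT (`A K a t τ`, `shA`, `pieceA`, and the B-twins over the index type `S.ι` and the classes `S.T`) with the (R) facts and the two pushes
(losses `M₁`, `M₂`) at every admissible assignment, N20's live windows, `κ_min`, `ρ_j ≤ ½`, the rate `ρ_j ≤ c₁ϑ^j` (N16) — AND an ADMISSIBLE ASSIGNMENT `a K` per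
comparison with the SELECTION CERTIFICATE (every slot of level `≤ K` satisfies (M1) at its level's threshold with `F̄∕((1−ρ)κ)`) such that the bundle's carriers ARE the
sharp object READ AT `a` (`S.A = A·(a·)`, …) and `S.Wsh ≥ 2((N₁+1)ν̄(M₁∕M₂·2F̄∕κ_min)c₁ϑ^{−N₁})ϑ^K` is summable — then `S_N21 SRec`.  The certificate is what §2's
`exists_goodAssignment` supplies to whoever builds the reading; the carriers are print's SHARP expansion at the chosen thresholds.  NO (M1) binder, no window average.
[folklore] -/
theorem s_N21_of_selectedSharpReading (SRec : SpineRecordPred N)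
    (hread : ∀ (F : T4Continuum.T4Family) (D : YMDAG.UVSplit.Datum F N) (g₀ : ℕ → ℝ)
      (os : List (T4Continuum.ULoop F)) (S : SpineCarriers), SRec F D g₀ os S →
      ∃ (σ : Type) (_dσ : DecidableEq σ) (X : ℕ → σ → Type) (_m : ∀ K s, MeasurableSpace (X K s))
        (SA SB : ℕ → Finset σ) (lvl : ℕ → σ → ℕ)
        (ν : ∀ K : ℕ, (ℕ → ℝ) → ∀ s : σ, Measure (X K s)) (_f : ∀ K a s, IsFiniteMeasure (ν K a s))
        (w : ∀ (K : ℕ) (s : σ), X K s → ℝ) (θ κ ρ : ℕ → ℝ) (Fbar : ℝ) (D' : ℕ → ℝ)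
        (A shA B shB : ℕ → (ℕ → ℝ) → ℝ → S.ι → ℝ) (pieceA pieceB : ℕ → (ℕ → ℝ) → ℝ → σ → S.ι → ℝ) (M₁ M₂ : ℝ)
        (N₁ : ℕ) (νbar κmin c₁ ϑ : ℝ) (a : ℕ → ℕ → ℝ),
        -- signs, windows, widths, the level constant
        (∀ j, 0 ≤ ρ j) ∧ 0 ≤ M₁ ∧ 0 < M₂ ∧ (∀ j, D' j = Fbar / ((1 - ρ j) * κ j)) ∧ 0 ≤ Fbar ∧
        0 < κmin ∧ (∀ j, κmin ≤ κ j) ∧ (∀ j, ρ j ≤ 1 / 2) ∧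
        -- the admissible assignment and its selection certificate (both runs' slots)
        (∀ K j, a K j ∈ Icc ((1 - κ j) * θ j) (θ j)) ∧
        (∀ K, ∀ s ∈ SA K ∪ SB K, SlotAntiConcentration (ν K (a K) s) (w K s) (a K (lvl K s)) (ρ (lvl K s)) (D' (lvl K s))) ∧
        -- the carriers ARE the sharp object read at `a`
        (S.A = fun K => A K (a K)) ∧ (S.shA = fun K => shA K (a K)) ∧ (S.B = fun K => B K (a K)) ∧ (S.shB = fun K => shB K (a K)) ∧
        -- run A at `a`: (R) and the two pushes
        (∀ K t, |t| ≤ S.l₀ → ∀ τ ∈ S.T K, 0 ≤ shA K (a K) t τ ∧ shA K (a K) t τ ≤ A K (a K) t τ ∧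
          shA K (a K) t τ ≤ ∑ s ∈ SA K, pieceA K (a K) t s τ) ∧
        (∀ K t, |t| ≤ S.l₀ → ∀ s ∈ SA K, ∑ τ ∈ S.T K, pieceA K (a K) t s τ ≤
          M₁ * (ν K (a K) s {x | a K (lvl K s) * (1 - ρ (lvl K s)) ≤ w K s x ∧ w K s x < a K (lvl K s)}).toReal) ∧
        (∀ K t, |t| ≤ S.l₀ → ∀ s ∈ SA K, M₂ * (ν K (a K) s univ).toReal ≤ ∑ τ ∈ S.T K, A K (a K) t τ) ∧
        -- run B at `a`
        (∀ K t, |t| ≤ S.l₀ → ∀ τ ∈ S.T K, 0 ≤ shB K (a K) t τ ∧ shB K (a K) t τ ≤ B K (a K) t τ ∧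
          shB K (a K) t τ ≤ ∑ s ∈ SB K, pieceB K (a K) t s τ) ∧
        (∀ K t, |t| ≤ S.l₀ → ∀ s ∈ SB K, ∑ τ ∈ S.T K, pieceB K (a K) t s τ ≤
          M₁ * (ν K (a K) s {x | a K (lvl K s) * (1 - ρ (lvl K s)) ≤ w K s x ∧ w K s x < a K (lvl K s)}).toReal) ∧
        (∀ K t, |t| ≤ S.l₀ → ∀ s ∈ SB K, M₂ * (ν K (a K) s univ).toReal ≤ ∑ τ ∈ S.T K, B K (a K) t τ) ∧
        -- windows (N20), rate (N16), record weight
        LiveWindow SA lvl N₁ νbar ∧ LiveWindow SB lvl N₁ νbar ∧ 0 < ϑ ∧ ϑ < 1 ∧ (∀ j, ρ j ≤ c₁ * ϑ ^ j) ∧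
        (∀ K, (2 * ((N₁ + 1) * νbar * (M₁ / M₂ * (2 * Fbar / κmin)) * c₁ * ϑ⁻¹ ^ N₁)) * ϑ ^ K ≤ S.Wsh K) ∧ Summable S.Wsh) :
    S_N21 SRec := by
  intro F D g₀ os S hS
  obtain ⟨σ, _dσ, X, _m, SA, SB, lvl, ν, _f, w, θ, κ, ρ, Fbar, D', A, shA, B, shB, pieceA, pieceB, M₁, M₂, N₁, νbar, κmin, c₁, ϑ, a,
    hρ0, hM₁, hM₂, hD', hFbar, hκmin, hκminle, hρhalf, hadm, hgood, hSA, hSshA, hSB, hSshB, hRA, hpushA, htotalA, hRB, hpushB, htotalB,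
    hwinA, hwinB, hϑ0, hϑ1, hrate, hWsh, hsum⟩ := hread F D g₀ os S hS
  have hD'0 : ∀ j, 0 ≤ D' j := fun j => by
    rw [hD' j]
    have h1 : 0 < 1 - ρ j := by linarith [hρhalf j]
    have h2 : 0 < κ j := lt_of_lt_of_le hκmin (hκminle j)
    positivity
  have hLA := levelLedger_of_goodAssignment (l₀ := S.l₀) (T := S.T) a
    (fun K s hs => hgood K s (Finset.mem_union_left _ hs)) hD'0 hρ0 hM₁ hM₂
    (fun K t ht τ hτ => (hRA K t ht τ hτ).1) (fun K t ht τ hτ => (hRA K t ht τ hτ).2.1) (fun K t ht τ hτ => (hRA K t ht τ hτ).2.2)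
    hpushA htotalA
  have hLB := levelLedger_of_goodAssignment (l₀ := S.l₀) (T := S.T) a
    (fun K s hs => hgood K s (Finset.mem_union_right _ hs)) hD'0 hρ0 hM₁ hM₂
    (fun K t ht τ hτ => (hRB K t ht τ hτ).1) (fun K t ht τ hτ => (hRB K t ht τ hτ).2.1) (fun K t ht τ hτ => (hRB K t ht τ hτ).2.2)
    hpushB htotalB
  have hD : ∀ j, M₁ / M₂ * D' j ≤ M₁ / M₂ * (2 * Fbar / κmin) := fun j => by
    rw [hD' j]
    exact mul_le_mul_of_nonneg_left (levelConst_le hFbar (hρhalf j) hκmin (hκminle j)) (div_nonneg hM₁ hM₂.le)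
  have h := n21_knit_levels hLA hLB hwinA hwinB hD hD hϑ0 hϑ1 hrate hrate hWsh hsum
  rw [hSA, hSshA, hSB, hSshB]
  exact h

end AtCarriers

end Summit.QuantumFields.YangMills.Theorems.N21SelectedThresholds

end
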